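import Summits.AtomisticToContinuum.Crystallization.Theses.FrustratedLawDichotomy
import Summits.AtomisticToContinuum.Crystallization.Theorems.FrustratedLawDichotomyFiniteClusterGap

/-!
# FrustratedLawDichotomy · crux `AperiodicFrustratedLawGap` (stmt-AtomisticToContinuum-27623) — EXACT CUT of the ROUTE DECL at the
# finite/infinite divide, by conditioning (decomp-a2c, prover hand 2, structural share)

The crux `Theses.FrustratedLawDichotomy.AperiodicFrustratedLawGap` (Φaper: every aperiodic texture-charging Nash δ-hard-core
point-stationary probability law has mean root energy `> e⋆`) carries NO ergodicity hypothesis, so the ergodic splitting used for the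
registered stub `stub_aperiodicErgodicGap` (`FrustratedLawDichotomyFiniteClusterGap.aperiodicErgodicGap_iff_infiniteCase`) is not
available.  It is replaced by CONDITIONING on the re-rooting-invariant event `{μ | μ univ = ∞}`:

* `isPointStationaryLaw_restrict_of_invariant` — a point-stationary law carried by rooted hard-core configurations, restricted to a
  Giry-measurable re-rooting-invariant event, is again point-stationary (Mecke identity tested with `1_H(μ)·g(μ, y)`; `1_H(θ_y μ) = 1_H(μ)` at
  atoms `y`);
* `setIntegral_ge_of_cond` — bookkeeping: a strict gap for the conditioned law `(P K)⁻¹ • P|K` is a strict gap for `∫_K`;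
* `aperiodicFrustratedLawGap_finiteCase` — Φaper HOLDS for laws almost surely carried by FINITE configurations (the decl's statement
  verbatim with one extra hypothesis; from `eStar_lt_integral_rootEnergy_of_ae_finite`);
* `aperiodicFrustratedLawGap_iff_infiniteCase` — **Φaper ⟺ Φaper restricted to laws almost surely carried by INFINITE configurations**
  (the ROUTE DECL BY NAME on the left): condition a putative counterexample on `{μ univ = ∞}` and on its complement; both conditioned laws
  inherit (a) (b) (d) (e) and aperiodicity, the finite part has a strict gap by the finite-cluster theorem, the infinite part by hypothesis,
  and the two strict gaps add up (a non-integrable root energy has integral `0 > e⋆`).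

So the crux — independently of the ergodic decomposition of its registered line — is EXACTLY its infinite-configuration core.  All `[folklore]`.
-/

noncomputable section

namespace Summit.AtomisticToContinuum.Crystallization.Theorems.FrustratedLawDichotomyAperiodicGapFiniteCut

open MeasureTheory Metric Set Filter ProbabilityTheory
open scoped ENNReal Topology BigOperators
open Literature.MathematicalPhysics.StatisticalMechanics Literature.Probability.Process
open Summit.AtomisticToContinuum.Crystallization.Theorems.ChargedEnergyGapNegative (E3 eStar)
open Summit.AtomisticToContinuum.Crystallization.Theorems.FrustratedLawDichotomyFiniteClusterGap
  (ae_mem_of_sep map_sub_univ count_restrict_univ_of_finite count_restrict_univ_of_infinite setOf_count_restrict_singleton_ne_zero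
    card_mul_eStar_lt_interactionEnergy eStar_lt_integral_rootEnergy_of_ae_finite)

/-! ## §1. Conditioning a point-stationary law on a re-rooting-invariant event -/

section Conditioning

variable {δ : ℝ} {P : Measure (Measure E3)}

/-- **Point-stationarity survives conditioning on invariant events.**  If `P` is point-stationary and almost surely carried by rooted
`δ`-hard-core configurations, and `H` is a Giry-measurable event invariant under re-rooting at atoms
(`μ ∈ H ↔ θ_p μ ∈ H` whenever `μ {p} ≠ 0`), then `P|H` is point-stationary. [folklore] -/
theorem isPointStationaryLaw_restrict_of_invariant (hδ : 0 < δ) (hcore : ∀ᵐ μ ∂P, IsRootedHardCore δ μ)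
    (hstat : IsPointStationaryLaw P) {H : Set (Measure E3)} (hH : MeasurableSet H)
    (hinv : ∀ μ : Measure E3, ∀ p : E3, μ {p} ≠ 0 → (μ ∈ H ↔ Measure.map (fun z : E3 => z - p) μ ∈ H)) :
    IsPointStationaryLaw (P.restrict H) := by
  classical
  intro g hg
  set g' : Measure E3 → E3 → ℝ≥0∞ := fun μ y => H.indicator (fun _ => (1 : ℝ≥0∞)) μ * g μ y with hg'
  have hg'm : Measurable (Function.uncurry g') :=
    ((measurable_const.indicator hH).comp measurable_fst).mul hg
  have hind : ∀ μ : Measure E3, H.indicator (fun _ => (1 : ℝ≥0∞)) μ ≠ ∞ := fun μ => by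
    by_cases h : μ ∈ H <;> simp [h]
  have hfac : ∀ (μ : Measure E3) (F : Measure E3 → ℝ≥0∞),
      H.indicator (fun _ => (1 : ℝ≥0∞)) μ * F μ = H.indicator F μ := fun μ F => by
    by_cases h : μ ∈ H <;> simp [h]
  have key := hstat g' hg'm
  have hL : ∫⁻ μ, ∫⁻ y, g' μ y ∂μ ∂P = ∫⁻ μ in H, ∫⁻ y, g μ y ∂μ ∂P := by
    rw [← lintegral_indicator hH]
    refine lintegral_congr fun μ => ?_
    simp only [hg']
    rw [lintegral_const_mul' _ _ (hind μ), hfac μ (fun μ => ∫⁻ y, g μ y ∂μ)]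
  have hR : ∫⁻ μ, ∫⁻ y, g' (Measure.map (fun z : E3 => z - y) μ) (-y) ∂μ ∂P =
      ∫⁻ μ in H, ∫⁻ y, g (Measure.map (fun z : E3 => z - y) μ) (-y) ∂μ ∂P := by
    rw [← lintegral_indicator hH]
    refine lintegral_congr_ae (hcore.mono fun μ hμ => ?_)
    obtain ⟨S, h0, hsep, rfl⟩ := hμ
    have hae : ∀ᵐ y ∂((Measure.count : Measure E3).restrict S),
        g' (Measure.map (fun z : E3 => z - y) ((Measure.count : Measure E3).restrict S)) (-y) =
          H.indicator (fun _ => (1 : ℝ≥0∞)) ((Measure.count : Measure E3).restrict S) *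
            g (Measure.map (fun z : E3 => z - y) ((Measure.count : Measure E3).restrict S)) (-y) := by
      refine (ae_mem_of_sep hδ hsep).mono fun y hy => ?_
      have hy' : (Measure.count : Measure E3).restrict S {y} ≠ 0 := (count_restrict_singleton_ne_zero_iff S y).2 hy
      simp only [hg']
      congr 1
      by_cases hμH : (Measure.count : Measure E3).restrict S ∈ H
      · rw [Set.indicator_of_mem hμH, Set.indicator_of_mem ((hinv _ _ hy').1 hμH)]
      · rw [Set.indicator_of_notMem hμH, Set.indicator_of_notMem (fun h => hμH ((hinv _ _ hy').2 h))]
    beta_reduce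
    rw [lintegral_congr_ae hae, lintegral_const_mul' _ _ (hind _),
      hfac _ (fun μ => ∫⁻ y, g (Measure.map (fun z : E3 => z - y) μ) (-y) ∂μ)]
  exact hL.symm.trans (key.trans hR)

/-- **A strict gap for the conditioned law is a strict gap on the event.**  For a probability law `P`, a measurable `K`, an integrable
`f` and a constant `c`: if `c < ∫ f d((P K)⁻¹ • P|K)` whenever `P K ≠ 0`, then `(P K)·c ≤ ∫_K f dP`, strictly if `P K ≠ 0`. [folklore] -/
theorem setIntegral_ge_of_cond [IsProbabilityMeasure P] {K : Set (Measure E3)} {f : Measure E3 → ℝ} {c : ℝ}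
    (hgap : P K ≠ 0 → c < ∫ μ, f μ ∂((P K)⁻¹ • P.restrict K)) :
    (P K).toReal * c ≤ ∫ μ in K, f μ ∂P ∧ (P K ≠ 0 → (P K).toReal * c < ∫ μ in K, f μ ∂P) := by
  by_cases hK0 : P K = 0
  · have hrest : P.restrict K = 0 := Measure.restrict_eq_zero.2 hK0
    refine ⟨?_, fun h => absurd hK0 h⟩
    rw [hK0, ENNReal.toReal_zero, zero_mul, hrest, integral_zero_measure]
  · have hpos : 0 < (P K).toReal := ENNReal.toReal_pos hK0 (measure_ne_top P K)
    have h := hgap hK0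
    rw [integral_smul_measure, ENNReal.toReal_inv, smul_eq_mul] at h
    have hlt : (P K).toReal * c < ∫ μ in K, f μ ∂P := by
      have := mul_lt_mul_of_pos_left h hpos
      rwa [← mul_assoc, mul_inv_cancel₀ hpos.ne', one_mul] at this
    exact ⟨hlt.le, fun _ => hlt⟩

/-- The conditioned law `(P K)⁻¹ • P|K` of a probability law on an event of positive mass is a probability law. [folklore] -/
theorem isProbabilityMeasure_cond' [IsProbabilityMeasure P] {K : Set (Measure E3)} (hK0 : P K ≠ 0) :
    IsProbabilityMeasure ((P K)⁻¹ • P.restrict K) :=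
  ⟨by rw [Measure.smul_apply, Measure.restrict_apply_univ, smul_eq_mul, ENNReal.inv_mul_cancel hK0 (measure_ne_top P K)]⟩

end Conditioning

/-! ## §2. The crux at the finite/infinite divide -/

section Cut

/-- `e⋆ < 0` (strict periodisation of a single particle). [folklore] -/
private theorem eStar_neg' : eStar < 0 := by
  have h := card_mul_eStar_lt_interactionEnergy (N := 1) one_pos (x := fun _ => (0 : E3)) (fun i j _ => Subsingleton.elim i j)
  rw [interactionEnergy_of_subsingleton] at h
  simpa using h

/-- **Φaper HOLDS for laws almost surely carried by FINITE configurations** (the crux's statement verbatim with the one extra hypothesis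
`∀ᵐ μ ∂P, {p | μ {p} ≠ 0}.Finite`; texture, Nash and aperiodicity idle). [folklore] -/
theorem aperiodicFrustratedLawGap_finiteCase :
    ∀ δ : ℝ, 0 < δ → ∀ P : MeasureTheory.Measure (MeasureTheory.Measure (EuclideanSpace ℝ (Fin 3))), let Gy : ℝ → (N : ℕ) → (Fin N → EuclideanSpace ℝ (Fin 3)) → Fin N → Prop := fun η N y j => let d : ℝ := sInf ((fun z => dist z (y (j : Fin N))) '' (Set.range (y) \ {(y (j : Fin N))})); let T : Set (EuclideanSpace ℝ (Fin 3)) := {z : EuclideanSpace ℝ (Fin 3) | z ∈ Set.range (y) ∧ z ≠ (y (j : Fin N)) ∧ dist z (y (j : Fin N)) < 13 / 10 * d}; ∃ A : EuclideanSpace ℝ (Fin 3) →ₗᵢ[ℝ] EuclideanSpace ℝ (Fin 3), (∃ e : ↥T ≃ ↥Literature.Geometry.DiscreteGeometry.fccKissingPattern, ∀ t : ↥T, dist (d⁻¹ • ((t : EuclideanSpace ℝ (Fin 3)) - (y (j : Fin N)))) (A ((e t : ↥Literature.Geometry.DiscreteGeometry.fccKissingPattern) : EuclideanSpace ℝ (Fin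 3))) ≤ η) ∨ (∃ e : ↥T ≃ ↥Literature.Geometry.DiscreteGeometry.hcpKissingPattern, ∀ t : ↥T, dist (d⁻¹ • ((t : EuclideanSpace ℝ (Fin 3)) - (y (j : Fin N)))) (A ((e t : ↥Literature.Geometry.DiscreteGeometry.hcpKissingPattern) : EuclideanSpace ℝ (Fin 3))) ≤ η); let TexBall : (N : ℕ) → (Fin N → EuclideanSpace ℝ (Fin 3)) → Fin N → ℝ → ℝ → ℝ → ℝ → Prop := fun N y i R R₇ R₈ R₉ => (∀ a b : Fin N, a ≠ b → (7 : ℝ) / 10 ≤ dist (y a) (y b)) ∧ (∀ j : Fin N, dist (y j) (y i) ≤ R → ¬ Gy (1 / 20) N (y) j) ∧ (∀ j : Fin N, dist (y j) (y i) ≤ R → ¬ ((∀ j' : Fin N, dist (y j') (y j) ≤ R₇ → ¬ Gy (1 / 20) N (y) j') ∧ (∀ z : EuclideanSpace ℝ (Fin 3), dist z (y j) ≤ R₇ → ∃ k : Fin N, dist z (y k) ≤ 1) ∧ (∀ j' : Fin N, dist (y j') (y j) ≤ R₇ → (let d : ℝ := sInf ((fun z => dist z (y j')) '' (Set.range (y)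 \ {(y j')})); ∀ k : Fin N, y k ≠ y j' → dist (y k) (y j') < 27 / 20 * d → 5 ≤ Nat.card {m : Fin N // y m ≠ y j' ∧ dist (y m) (y j') < 27 / 20 * d ∧ y m ≠ y k ∧ dist (y m) (y k) < 27 / 20 * d})))) ∧ (∀ j : Fin N, dist (y j) (y i) ≤ R → ∃ k : Fin N, dist (y k) (y j) ≤ R₈ ∧ Gy (1 / 8) N (y) k) ∧ (∀ j : Fin N, dist (y j) (y i) ≤ R → ¬ ((∀ j' : Fin N, dist (y j') (y j) ≤ R₉ → ¬ Gy (1 / 20) N (y) j') ∧ (Nat.card {j' : Fin N // dist (y j') (y j) ≤ R₉ ∧ ¬ Gy (1 / 8) N (y) j'} : ℝ) ≤ 1 / 2 * (Nat.card {j' : Fin N // dist (y j') (y j) ≤ R₉} : ℝ) ∧ (∀ j' : Fin N, dist (y j') (y j) ≤ R₉ → ¬ Gy (1 / 8) N (y) j' → ¬ (let d : ℝ := sInf ((fun z => dist z (y j')) '' (Set.range (y) \ {(y j')})); ∀ k : Fin N, y k ≠ y j' → dist (y k) (y j') < 27 / 20 * d → 5 ≤ Nat.card {m : Fin N // y m ≠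 y j' ∧ dist (y m) (y j') < 27 / 20 * d ∧ y m ≠ y k ∧ dist (y m) (y k) < 27 / 20 * d})))); let Appr : MeasureTheory.Measure (EuclideanSpace ℝ (Fin 3)) → ℝ → ℝ → ℝ → Prop := fun μ R₇ R₈ R₉ => ∀ q : EuclideanSpace ℝ (Fin 3), μ {q} ≠ 0 → ∀ R ε : ℝ, 0 < ε → ∃ (N : ℕ) (y : Fin N → EuclideanSpace ℝ (Fin 3)) (i : Fin N), TexBall N y i R R₇ R₈ R₉ ∧ (∀ p : EuclideanSpace ℝ (Fin 3), μ {p} ≠ 0 → dist p q ≤ R → ∃ k : Fin N, dist (y k - y i) (p - q) ≤ ε) ∧ (∀ k : Fin N, dist (y k) (y i) ≤ R → ∃ p : EuclideanSpace ℝ (Fin 3), μ {p} ≠ 0 ∧ dist (y k - y i) (p - q) ≤ ε); MeasureTheory.IsProbabilityMeasure P → (∀ᵐ μ ∂P, Literature.Probability.Process.IsRootedHardCore δ μ) → Literature.Probability.Process.IsPointStationaryLaw P → (∃ R₇ R₈ R₉ : ℝ, ∀ᵐ μ ∂P, Appr μ R₇ R₈ R₉) → (∀ᵐ μ ∂P,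 ∀ p : EuclideanSpace ℝ (Fin 3), μ {p} ≠ 0 → ∀ y : EuclideanSpace ℝ (Fin 3), (∀ q : EuclideanSpace ℝ (Fin 3), μ {q} ≠ 0 → q ≠ p → y ≠ q) → ∑' q : {q : EuclideanSpace ℝ (Fin 3) // μ {q} ≠ 0 ∧ q ≠ p}, Literature.MathematicalPhysics.StatisticalMechanics.lennardJones (dist p (q : EuclideanSpace ℝ (Fin 3))) ≤ ∑' q : {q : EuclideanSpace ℝ (Fin 3) // μ {q} ≠ 0 ∧ q ≠ p}, Literature.MathematicalPhysics.StatisticalMechanics.lennardJones (dist y (q : EuclideanSpace ℝ (Fin 3)))) → P {μ : MeasureTheory.Measure (EuclideanSpace ℝ (Fin 3)) | ∃ Q : Literature.MathematicalPhysics.StatisticalMechanics.PeriodicConfiguration 3, ∃ t : EuclideanSpace ℝ (Fin 3), {p : EuclideanSpace ℝ (Fin 3) | μ {p} ≠ 0} = (fun s => s + t) '' Q.points} = 0 → (∀ᵐ μ ∂P, {p : EuclideanSpace ℝ (Fin 3) | μ {p} ≠ 0}.Finite) → (⨅ Q : Literature.MathematicalPhysics.StatisticalMechanics.PeriodicConfiguration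 3, Q.energyPerParticle Literature.MathematicalPhysics.StatisticalMechanics.lennardJones) < (∫ μ, Literature.MathematicalPhysics.StatisticalMechanics.rootEnergy Literature.MathematicalPhysics.StatisticalMechanics.lennardJones μ ∂P) := by
  intro δ hδ P
  dsimp only
  intro _hP ha hb _ _ _ hfin
  exact eStar_lt_integral_rootEnergy_of_ae_finite hδ ha hb hfin

/-- **EXACT CUT OF THE CRUX: `AperiodicFrustratedLawGap` ⟺ its restriction to laws almost surely carried by INFINITE configurations**
(the route decl by name on the left; on the right its statement verbatim with the one extra hypothesis `∀ᵐ μ ∂P, {p | μ {p} ≠ 0}.Infinite`).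
Proof of `←`: condition on the re-rooting-invariant events `{μ univ = ∞}` / `{μ univ ≠ ∞}`; both conditioned laws stay in the frame
(`isPointStationaryLaw_restrict_of_invariant`); the finite part has a strict gap (`eStar_lt_integral_rootEnergy_of_ae_finite`), the infinite
part by hypothesis; `setIntegral_ge_of_cond` adds them up. [folklore] -/
theorem aperiodicFrustratedLawGap_iff_infiniteCase :
    Summit.AtomisticToContinuum.Crystallization.Theses.FrustratedLawDichotomy.AperiodicFrustratedLawGap ↔
    (∀ δ : ℝ, 0 < δ → ∀ P : MeasureTheory.Measure (MeasureTheory.Measure (EuclideanSpace ℝ (Fin 3))), let Gy : ℝ → (N : ℕ) → (Fin N → EuclideanSpace ℝ (Fin 3)) → Fin N → Prop := fun η N y j => let d : ℝ := sInf ((fun z => dist z (y (j : Fin N))) '' (Set.range (y) \ {(y (j : Fin N))})); let T : Set (EuclideanSpace ℝ (Fin 3)) := {z : EuclideanSpace ℝ (Fin 3) | z ∈ Set.range (y) ∧ z ≠ (y (j : Fin N)) ∧ dist z (y (j : Fin N)) < 13 / 10 * d}; ∃ A : EuclideanSpace ℝ (Fin 3) →ₗᵢ[ℝ] EuclideanSpace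 ℝ (Fin 3), (∃ e : ↥T ≃ ↥Literature.Geometry.DiscreteGeometry.fccKissingPattern, ∀ t : ↥T, dist (d⁻¹ • ((t : EuclideanSpace ℝ (Fin 3)) - (y (j : Fin N)))) (A ((e t : ↥Literature.Geometry.DiscreteGeometry.fccKissingPattern) : EuclideanSpace ℝ (Fin 3))) ≤ η) ∨ (∃ e : ↥T ≃ ↥Literature.Geometry.DiscreteGeometry.hcpKissingPattern, ∀ t : ↥T, dist (d⁻¹ • ((t : EuclideanSpace ℝ (Fin 3)) - (y (j : Fin N)))) (A ((e t : ↥Literature.Geometry.DiscreteGeometry.hcpKissingPattern) : EuclideanSpace ℝ (Fin 3))) ≤ η); let TexBall : (N : ℕ) → (Fin N → EuclideanSpace ℝ (Fin 3)) → Fin N → ℝ → ℝ → ℝ → ℝ → Prop := fun N y i R R₇ R₈ R₉ => (∀ a b : Fin N, a ≠ b → (7 : ℝ) / 10 ≤ dist (y a) (y b)) ∧ (∀ j : Fin N, dist (y j) (y i) ≤ R → ¬ Gy (1 / 20) N (y) j) ∧ (∀ j : Fin N, dist (y j) (y i) ≤ R → ¬ ((∀ j' : Fin N, dist (y j') (y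 j) ≤ R₇ → ¬ Gy (1 / 20) N (y) j') ∧ (∀ z : EuclideanSpace ℝ (Fin 3), dist z (y j) ≤ R₇ → ∃ k : Fin N, dist z (y k) ≤ 1) ∧ (∀ j' : Fin N, dist (y j') (y j) ≤ R₇ → (let d : ℝ := sInf ((fun z => dist z (y j')) '' (Set.range (y) \ {(y j')})); ∀ k : Fin N, y k ≠ y j' → dist (y k) (y j') < 27 / 20 * d → 5 ≤ Nat.card {m : Fin N // y m ≠ y j' ∧ dist (y m) (y j') < 27 / 20 * d ∧ y m ≠ y k ∧ dist (y m) (y k) < 27 / 20 * d})))) ∧ (∀ j : Fin N, dist (y j) (y i) ≤ R → ∃ k : Fin N, dist (y k) (y j) ≤ R₈ ∧ Gy (1 / 8) N (y) k) ∧ (∀ j : Fin N, dist (y j) (y i) ≤ R → ¬ ((∀ j' : Fin N, dist (y j') (y j) ≤ R₉ → ¬ Gy (1 / 20) N (y) j') ∧ (Nat.card {j' : Fin N // dist (y j') (y j) ≤ R₉ ∧ ¬ Gy (1 / 8) N (y) j'} : ℝ) ≤ 1 / 2 * (Nat.card {j' : Fin N // dist (y j') (y j) ≤ R₉} : ℝ)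 ∧ (∀ j' : Fin N, dist (y j') (y j) ≤ R₉ → ¬ Gy (1 / 8) N (y) j' → ¬ (let d : ℝ := sInf ((fun z => dist z (y j')) '' (Set.range (y) \ {(y j')})); ∀ k : Fin N, y k ≠ y j' → dist (y k) (y j') < 27 / 20 * d → 5 ≤ Nat.card {m : Fin N // y m ≠ y j' ∧ dist (y m) (y j') < 27 / 20 * d ∧ y m ≠ y k ∧ dist (y m) (y k) < 27 / 20 * d})))); let Appr : MeasureTheory.Measure (EuclideanSpace ℝ (Fin 3)) → ℝ → ℝ → ℝ → Prop := fun μ R₇ R₈ R₉ => ∀ q : EuclideanSpace ℝ (Fin 3), μ {q} ≠ 0 → ∀ R ε : ℝ, 0 < ε → ∃ (N : ℕ) (y : Fin N → EuclideanSpace ℝ (Fin 3)) (i : Fin N), TexBall N y i R R₇ R₈ R₉ ∧ (∀ p : EuclideanSpace ℝ (Fin 3), μ {p} ≠ 0 → dist p q ≤ R → ∃ k : Fin N, dist (y k - y i) (p - q) ≤ ε) ∧ (∀ k : Fin N, dist (y k) (y i) ≤ R → ∃ p : EuclideanSpace ℝ (Fin 3), μ {p} ≠ 0 ∧ dist (y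 k - y i) (p - q) ≤ ε); MeasureTheory.IsProbabilityMeasure P → (∀ᵐ μ ∂P, Literature.Probability.Process.IsRootedHardCore δ μ) → Literature.Probability.Process.IsPointStationaryLaw P → (∃ R₇ R₈ R₉ : ℝ, ∀ᵐ μ ∂P, Appr μ R₇ R₈ R₉) → (∀ᵐ μ ∂P, ∀ p : EuclideanSpace ℝ (Fin 3), μ {p} ≠ 0 → ∀ y : EuclideanSpace ℝ (Fin 3), (∀ q : EuclideanSpace ℝ (Fin 3), μ {q} ≠ 0 → q ≠ p → y ≠ q) → ∑' q : {q : EuclideanSpace ℝ (Fin 3) // μ {q} ≠ 0 ∧ q ≠ p}, Literature.MathematicalPhysics.StatisticalMechanics.lennardJones (dist p (q : EuclideanSpace ℝ (Fin 3))) ≤ ∑' q : {q : EuclideanSpace ℝ (Fin 3) // μ {q} ≠ 0 ∧ q ≠ p}, Literature.MathematicalPhysics.StatisticalMechanics.lennardJones (dist y (q : EuclideanSpace ℝ (Fin 3)))) → P {μ : MeasureTheory.Measure (EuclideanSpace ℝ (Fin 3)) | ∃ Q : Literature.MathematicalPhysics.StatisticalMechanics.PeriodicConfiguration 3, ∃ t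 : EuclideanSpace ℝ (Fin 3), {p : EuclideanSpace ℝ (Fin 3) | μ {p} ≠ 0} = (fun s => s + t) '' Q.points} = 0 → (∀ᵐ μ ∂P, {p : EuclideanSpace ℝ (Fin 3) | μ {p} ≠ 0}.Infinite) → (⨅ Q : Literature.MathematicalPhysics.StatisticalMechanics.PeriodicConfiguration 3, Q.energyPerParticle Literature.MathematicalPhysics.StatisticalMechanics.lennardJones) < (∫ μ, Literature.MathematicalPhysics.StatisticalMechanics.rootEnergy Literature.MathematicalPhysics.StatisticalMechanics.lennardJones μ ∂P)) := by
  constructor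
  · intro h δ hδ P
    have h' := h δ hδ P
    dsimp only at h' ⊢
    intro hP ha hb hd he h0 _
    exact h' hP ha hb hd he h0
  · intro h δ hδ P
    have h' := h δ hδ
    dsimp only at h' ⊢
    intro hP ha hb hd he h0
    -- the invariant event and its complement
    set H : Set (Measure E3) := {μ : Measure E3 | μ univ = ∞} with hHdef
    have hH : MeasurableSet H := (Measure.measurable_coe MeasurableSet.univ) (measurableSet_singleton ∞)
    have hinv : ∀ μ : Measure E3, ∀ p : E3, μ {p} ≠ 0 → (μ ∈ H ↔ Measure.map (fun z : E3 => z - p) μ ∈ H) :=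
      fun μ p _ => by simp only [hHdef, Set.mem_setOf_eq, map_sub_univ]
    have hinvc : ∀ μ : Measure E3, ∀ p : E3, μ {p} ≠ 0 → (μ ∈ Hᶜ ↔ Measure.map (fun z : E3 => z - p) μ ∈ Hᶜ) :=
      fun μ p hp => by rw [Set.mem_compl_iff, Set.mem_compl_iff, hinv μ p hp]
    -- junk case: a non-integrable root energy has integral `0 > e⋆`
    by_cases hint : Integrable (fun μ : Measure E3 => rootEnergy lennardJones μ) P
    swap
    · rw [integral_undef hint]; exact eStar_neg'
    -- the conditioned laws stay in the frame
    have hframe : ∀ (K : Set (Measure E3)), MeasurableSet K →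
        (∀ μ : Measure E3, ∀ p : E3, μ {p} ≠ 0 → (μ ∈ K ↔ Measure.map (fun z : E3 => z - p) μ ∈ K)) → P K ≠ 0 →
        IsProbabilityMeasure ((P K)⁻¹ • P.restrict K) ∧
        (∀ᵐ μ ∂((P K)⁻¹ • P.restrict K), IsRootedHardCore δ μ) ∧
        IsPointStationaryLaw ((P K)⁻¹ • P.restrict K) ∧
        (∀ᵐ μ ∂((P K)⁻¹ • P.restrict K), μ ∈ K) ∧
        ((P K)⁻¹ • P.restrict K) {μ : Measure E3 | ∃ Q : PeriodicConfiguration 3, ∃ t : E3,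
            {p : E3 | μ {p} ≠ 0} = (fun s => s + t) '' Q.points} = 0 := by
      intro K hK hinvK hK0
      refine ⟨isProbabilityMeasure_cond' hK0, Measure.ae_smul_measure (ae_restrict_of_ae ha) _,
        (isPointStationaryLaw_restrict_of_invariant hδ ha hb hK hinvK).smul _, Measure.ae_smul_measure (ae_restrict_mem hK) _, ?_⟩
      rw [Measure.smul_apply, smul_eq_mul]
      refine mul_eq_zero_of_right _ (le_antisymm ?_ bot_le)
      exact (Measure.le_iff'.1 Measure.restrict_le_self _).trans h0.le
    -- the two pieces
    have hpieceH := setIntegral_ge_of_cond (P := P) (K := H) (f := fun μ => rootEnergy lennardJones μ) (c := eStar) (fun hK0 => by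
      obtain ⟨hP', ha', hb', hK', h0'⟩ := hframe H hH hinv hK0
      refine h' _ hP' ha' hb' ?_ ?_ h0' ?_
      · obtain ⟨R₇, R₈, R₉, hd'⟩ := hd
        exact ⟨R₇, R₈, R₉, Measure.ae_smul_measure (ae_restrict_of_ae hd') _⟩
      · exact Measure.ae_smul_measure (ae_restrict_of_ae he) _
      · filter_upwards [ha', hK'] with μ hμ hμK
        obtain ⟨S, h0S, hsep, rfl⟩ := hμ
        rw [setOf_count_restrict_singleton_ne_zero]
        intro hS
        exact ENNReal.natCast_ne_top _ ((count_restrict_univ_of_finite hS).symm.trans hμK))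
    have hpieceHc := setIntegral_ge_of_cond (P := P) (K := Hᶜ) (f := fun μ => rootEnergy lennardJones μ) (c := eStar) (fun hK0 => by
      obtain ⟨hP', ha', hb', hK', -⟩ := hframe Hᶜ hH.compl hinvc hK0
      refine eStar_lt_integral_rootEnergy_of_ae_finite hδ ha' hb' ?_
      filter_upwards [ha', hK'] with μ hμ hμK
      obtain ⟨S, h0S, hsep, rfl⟩ := hμ
      rw [setOf_count_restrict_singleton_ne_zero]
      by_contra hS
      exact hμK (count_restrict_univ_of_infinite hS))
    -- add up
    have hsum : ∫ μ in H, rootEnergy lennardJones μ ∂P + ∫ μ in Hᶜ, rootEnergy lennardJones μ ∂P =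
        ∫ μ, rootEnergy lennardJones μ ∂P := integral_add_compl hH hint
    have hmass : (P H).toReal + (P Hᶜ).toReal = 1 := by
      rw [← ENNReal.toReal_add (measure_ne_top P H) (measure_ne_top P Hᶜ), measure_add_measure_compl hH, measure_univ,
        ENNReal.toReal_one]
    rw [← hsum]
    change eStar < _
    have hm' : (P H).toReal * eStar + (P Hᶜ).toReal * eStar = eStar := by rw [← add_mul, hmass, one_mul]
    by_cases hH0 : P H = 0
    · have hHc0 : P Hᶜ ≠ 0 := by
        intro h
        rw [hH0, h, ENNReal.toReal_zero, add_zero] at hmass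
        exact zero_ne_one hmass
      have h1 := hpieceH.1
      have h2 := hpieceHc.2 hHc0
      linarith
    · have h1 := hpieceH.2 hH0
      have h2 := hpieceHc.1
      linarith

end Cut


/-! ## §3. The GENERIC exact cut by a settled re-rooting-invariant class

`aperiodicFrustratedLawGap_cut`: for every Giry-measurable event `K` invariant under re-rooting at atoms (a translation-invariant property
of the atom set), IF the crux holds for the laws almost surely carried by `K` (a SETTLED CLASS), THEN the crux (by name) is EQUIVALENT to its
restriction to laws almost surely carried by `Kᶜ` — same conditioning proof as §2 with the finite class replaced by `K`.  Every further
settled invariant class (slabs, rods, isometry-atomic laws, …) thus peels off the declared residual EXACTLY, with no ergodic decomposition;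
`aperiodicFrustratedLawGap_iff_offFinite` re-derives the finite/infinite cut as the instance `K = {μ | μ univ ≠ ∞}`. -/

section GenericCut

/-- **GENERIC EXACT CUT of the crux by a settled re-rooting-invariant class.**  For a Giry-measurable event `K` invariant under re-rooting
at atoms: if `AperiodicFrustratedLawGap` holds for the laws almost surely carried by `K` (hypothesis `hgapK`: the crux's statement verbatim
with the extra hypothesis `∀ᵐ μ ∂P, μ ∈ K`), then the crux (route decl, by name) is equivalent to its restriction to laws almost surely
carried by `Kᶜ` (its statement verbatim with the extra hypothesis `∀ᵐ μ ∂P, μ ∈ Kᶜ`). [folklore] -/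
theorem aperiodicFrustratedLawGap_cut (K : Set (MeasureTheory.Measure (EuclideanSpace ℝ (Fin 3)))) (hK : MeasurableSet K)
    (hinvK : ∀ μ : MeasureTheory.Measure (EuclideanSpace ℝ (Fin 3)), ∀ p : EuclideanSpace ℝ (Fin 3), μ {p} ≠ 0 →
      (μ ∈ K ↔ MeasureTheory.Measure.map (fun z : EuclideanSpace ℝ (Fin 3) => z - p) μ ∈ K))
    (hgapK : ∀ δ : ℝ, 0 < δ → ∀ P : MeasureTheory.Measure (MeasureTheory.Measure (EuclideanSpace ℝ (Fin 3))), let Gy : ℝ → (N : ℕ) → (Fin N → EuclideanSpace ℝ (Fin 3)) → Fin N → Prop := fun η N y j => let d : ℝ := sInf ((fun z => dist z (y (j : Fin N))) '' (Set.range (y) \ {(y (j : Fin N))})); let T : Set (EuclideanSpace ℝ (Fin 3)) := {z : EuclideanSpace ℝ (Fin 3) | z ∈ Set.range (y) ∧ z ≠ (y (j : Fin N)) ∧ dist z (y (j : Fin N)) < 13 / 10 * d}; ∃ A : EuclideanSpace ℝ (Fin 3) →ₗᵢ[ℝ] EuclideanSpace ℝ (Fin 3), (∃ e : ↥T ≃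 ↥Literature.Geometry.DiscreteGeometry.fccKissingPattern, ∀ t : ↥T, dist (d⁻¹ • ((t : EuclideanSpace ℝ (Fin 3)) - (y (j : Fin N)))) (A ((e t : ↥Literature.Geometry.DiscreteGeometry.fccKissingPattern) : EuclideanSpace ℝ (Fin 3))) ≤ η) ∨ (∃ e : ↥T ≃ ↥Literature.Geometry.DiscreteGeometry.hcpKissingPattern, ∀ t : ↥T, dist (d⁻¹ • ((t : EuclideanSpace ℝ (Fin 3)) - (y (j : Fin N)))) (A ((e t : ↥Literature.Geometry.DiscreteGeometry.hcpKissingPattern) : EuclideanSpace ℝ (Fin 3))) ≤ η); let TexBall : (N : ℕ) → (Fin N → EuclideanSpace ℝ (Fin 3)) → Fin N → ℝ → ℝ → ℝ → ℝ → Prop := fun N y i R R₇ R₈ R₉ => (∀ a b : Fin N, a ≠ b → (7 : ℝ) / 10 ≤ dist (y a) (y b)) ∧ (∀ j : Fin N, dist (y j) (y i) ≤ R → ¬ Gy (1 / 20) N (y) j) ∧ (∀ j : Fin N, dist (y j) (y i) ≤ R → ¬ ((∀ j' : Fin N, dist (y j') (y j) ≤ R₇ → ¬ Gy (1 / 20)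 N (y) j') ∧ (∀ z : EuclideanSpace ℝ (Fin 3), dist z (y j) ≤ R₇ → ∃ k : Fin N, dist z (y k) ≤ 1) ∧ (∀ j' : Fin N, dist (y j') (y j) ≤ R₇ → (let d : ℝ := sInf ((fun z => dist z (y j')) '' (Set.range (y) \ {(y j')})); ∀ k : Fin N, y k ≠ y j' → dist (y k) (y j') < 27 / 20 * d → 5 ≤ Nat.card {m : Fin N // y m ≠ y j' ∧ dist (y m) (y j') < 27 / 20 * d ∧ y m ≠ y k ∧ dist (y m) (y k) < 27 / 20 * d})))) ∧ (∀ j : Fin N, dist (y j) (y i) ≤ R → ∃ k : Fin N, dist (y k) (y j) ≤ R₈ ∧ Gy (1 / 8) N (y) k) ∧ (∀ j : Fin N, dist (y j) (y i) ≤ R → ¬ ((∀ j' : Fin N, dist (y j') (y j) ≤ R₉ → ¬ Gy (1 / 20) N (y) j') ∧ (Nat.card {j' : Fin N // dist (y j') (y j) ≤ R₉ ∧ ¬ Gy (1 / 8) N (y) j'} : ℝ) ≤ 1 / 2 * (Nat.card {j' : Fin N // dist (y j') (y j) ≤ R₉} : ℝ) ∧ (∀ j' : Fin N, dist (y j') (y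 j) ≤ R₉ → ¬ Gy (1 / 8) N (y) j' → ¬ (let d : ℝ := sInf ((fun z => dist z (y j')) '' (Set.range (y) \ {(y j')})); ∀ k : Fin N, y k ≠ y j' → dist (y k) (y j') < 27 / 20 * d → 5 ≤ Nat.card {m : Fin N // y m ≠ y j' ∧ dist (y m) (y j') < 27 / 20 * d ∧ y m ≠ y k ∧ dist (y m) (y k) < 27 / 20 * d})))); let Appr : MeasureTheory.Measure (EuclideanSpace ℝ (Fin 3)) → ℝ → ℝ → ℝ → Prop := fun μ R₇ R₈ R₉ => ∀ q : EuclideanSpace ℝ (Fin 3), μ {q} ≠ 0 → ∀ R ε : ℝ, 0 < ε → ∃ (N : ℕ) (y : Fin N → EuclideanSpace ℝ (Fin 3)) (i : Fin N), TexBall N y i R R₇ R₈ R₉ ∧ (∀ p : EuclideanSpace ℝ (Fin 3), μ {p} ≠ 0 → dist p q ≤ R → ∃ k : Fin N, dist (y k - y i) (p - q) ≤ ε) ∧ (∀ k : Fin N, dist (y k) (y i) ≤ R → ∃ p : EuclideanSpace ℝ (Fin 3), μ {p} ≠ 0 ∧ dist (y k - y i) (p - q) ≤ ε); MeasureTheory.IsProbabilityMeasure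 P → (∀ᵐ μ ∂P, Literature.Probability.Process.IsRootedHardCore δ μ) → Literature.Probability.Process.IsPointStationaryLaw P → (∃ R₇ R₈ R₉ : ℝ, ∀ᵐ μ ∂P, Appr μ R₇ R₈ R₉) → (∀ᵐ μ ∂P, ∀ p : EuclideanSpace ℝ (Fin 3), μ {p} ≠ 0 → ∀ y : EuclideanSpace ℝ (Fin 3), (∀ q : EuclideanSpace ℝ (Fin 3), μ {q} ≠ 0 → q ≠ p → y ≠ q) → ∑' q : {q : EuclideanSpace ℝ (Fin 3) // μ {q} ≠ 0 ∧ q ≠ p}, Literature.MathematicalPhysics.StatisticalMechanics.lennardJones (dist p (q : EuclideanSpace ℝ (Fin 3))) ≤ ∑' q : {q : EuclideanSpace ℝ (Fin 3) // μ {q} ≠ 0 ∧ q ≠ p}, Literature.MathematicalPhysics.StatisticalMechanics.lennardJones (dist y (q : EuclideanSpace ℝ (Fin 3)))) → P {μ : MeasureTheory.Measure (EuclideanSpace ℝ (Fin 3)) | ∃ Q : Literature.MathematicalPhysics.StatisticalMechanics.PeriodicConfiguration 3, ∃ t : EuclideanSpace ℝ (Fin 3), {p : EuclideanSpace ℝ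 (Fin 3) | μ {p} ≠ 0} = (fun s => s + t) '' Q.points} = 0 → (∀ᵐ μ ∂P, μ ∈ K) → (⨅ Q : Literature.MathematicalPhysics.StatisticalMechanics.PeriodicConfiguration 3, Q.energyPerParticle Literature.MathematicalPhysics.StatisticalMechanics.lennardJones) < (∫ μ, Literature.MathematicalPhysics.StatisticalMechanics.rootEnergy Literature.MathematicalPhysics.StatisticalMechanics.lennardJones μ ∂P)) :
    Summit.AtomisticToContinuum.Crystallization.Theses.FrustratedLawDichotomy.AperiodicFrustratedLawGap ↔
    (∀ δ : ℝ, 0 < δ → ∀ P : MeasureTheory.Measure (MeasureTheory.Measure (EuclideanSpace ℝ (Fin 3))), let Gy : ℝ → (N : ℕ) → (Fin N → EuclideanSpace ℝ (Fin 3)) → Fin N → Prop := fun η N y j => let d : ℝ := sInf ((fun z => dist z (y (j : Fin N))) '' (Set.range (y) \ {(y (j : Fin N))})); let T : Set (EuclideanSpace ℝ (Fin 3)) := {z : EuclideanSpace ℝ (Fin 3) | z ∈ Set.range (y) ∧ z ≠ (y (j : Fin N)) ∧ dist z (y (j : Fin N)) < 13 / 10 * d}; ∃ A : EuclideanSpace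 ℝ (Fin 3) →ₗᵢ[ℝ] EuclideanSpace ℝ (Fin 3), (∃ e : ↥T ≃ ↥Literature.Geometry.DiscreteGeometry.fccKissingPattern, ∀ t : ↥T, dist (d⁻¹ • ((t : EuclideanSpace ℝ (Fin 3)) - (y (j : Fin N)))) (A ((e t : ↥Literature.Geometry.DiscreteGeometry.fccKissingPattern) : EuclideanSpace ℝ (Fin 3))) ≤ η) ∨ (∃ e : ↥T ≃ ↥Literature.Geometry.DiscreteGeometry.hcpKissingPattern, ∀ t : ↥T, dist (d⁻¹ • ((t : EuclideanSpace ℝ (Fin 3)) - (y (j : Fin N)))) (A ((e t : ↥Literature.Geometry.DiscreteGeometry.hcpKissingPattern) : EuclideanSpace ℝ (Fin 3))) ≤ η); let TexBall : (N : ℕ) → (Fin N → EuclideanSpace ℝ (Fin 3)) → Fin N → ℝ → ℝ → ℝ → ℝ → Prop := fun N y i R R₇ R₈ R₉ => (∀ a b : Fin N, a ≠ b → (7 : ℝ) / 10 ≤ dist (y a) (y b)) ∧ (∀ j : Fin N, dist (y j) (y i) ≤ R → ¬ Gy (1 / 20) N (y) j) ∧ (∀ j : Fin N, dist (y j) (y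 i) ≤ R → ¬ ((∀ j' : Fin N, dist (y j') (y j) ≤ R₇ → ¬ Gy (1 / 20) N (y) j') ∧ (∀ z : EuclideanSpace ℝ (Fin 3), dist z (y j) ≤ R₇ → ∃ k : Fin N, dist z (y k) ≤ 1) ∧ (∀ j' : Fin N, dist (y j') (y j) ≤ R₇ → (let d : ℝ := sInf ((fun z => dist z (y j')) '' (Set.range (y) \ {(y j')})); ∀ k : Fin N, y k ≠ y j' → dist (y k) (y j') < 27 / 20 * d → 5 ≤ Nat.card {m : Fin N // y m ≠ y j' ∧ dist (y m) (y j') < 27 / 20 * d ∧ y m ≠ y k ∧ dist (y m) (y k) < 27 / 20 * d})))) ∧ (∀ j : Fin N, dist (y j) (y i) ≤ R → ∃ k : Fin N, dist (y k) (y j) ≤ R₈ ∧ Gy (1 / 8) N (y) k) ∧ (∀ j : Fin N, dist (y j) (y i) ≤ R → ¬ ((∀ j' : Fin N, dist (y j') (y j) ≤ R₉ → ¬ Gy (1 / 20) N (y) j') ∧ (Nat.card {j' : Fin N // dist (y j') (y j) ≤ R₉ ∧ ¬ Gy (1 / 8) N (y) j'} : ℝ) ≤ 1 / 2 * (Nat.card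 {j' : Fin N // dist (y j') (y j) ≤ R₉} : ℝ) ∧ (∀ j' : Fin N, dist (y j') (y j) ≤ R₉ → ¬ Gy (1 / 8) N (y) j' → ¬ (let d : ℝ := sInf ((fun z => dist z (y j')) '' (Set.range (y) \ {(y j')})); ∀ k : Fin N, y k ≠ y j' → dist (y k) (y j') < 27 / 20 * d → 5 ≤ Nat.card {m : Fin N // y m ≠ y j' ∧ dist (y m) (y j') < 27 / 20 * d ∧ y m ≠ y k ∧ dist (y m) (y k) < 27 / 20 * d})))); let Appr : MeasureTheory.Measure (EuclideanSpace ℝ (Fin 3)) → ℝ → ℝ → ℝ → Prop := fun μ R₇ R₈ R₉ => ∀ q : EuclideanSpace ℝ (Fin 3), μ {q} ≠ 0 → ∀ R ε : ℝ, 0 < ε → ∃ (N : ℕ) (y : Fin N → EuclideanSpace ℝ (Fin 3)) (i : Fin N), TexBall N y i R R₇ R₈ R₉ ∧ (∀ p : EuclideanSpace ℝ (Fin 3), μ {p} ≠ 0 → dist p q ≤ R → ∃ k : Fin N, dist (y k - y i) (p - q) ≤ ε) ∧ (∀ k : Fin N, dist (y k) (y i) ≤ R → ∃ p : EuclideanSpace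 ℝ (Fin 3), μ {p} ≠ 0 ∧ dist (y k - y i) (p - q) ≤ ε); MeasureTheory.IsProbabilityMeasure P → (∀ᵐ μ ∂P, Literature.Probability.Process.IsRootedHardCore δ μ) → Literature.Probability.Process.IsPointStationaryLaw P → (∃ R₇ R₈ R₉ : ℝ, ∀ᵐ μ ∂P, Appr μ R₇ R₈ R₉) → (∀ᵐ μ ∂P, ∀ p : EuclideanSpace ℝ (Fin 3), μ {p} ≠ 0 → ∀ y : EuclideanSpace ℝ (Fin 3), (∀ q : EuclideanSpace ℝ (Fin 3), μ {q} ≠ 0 → q ≠ p → y ≠ q) → ∑' q : {q : EuclideanSpace ℝ (Fin 3) // μ {q} ≠ 0 ∧ q ≠ p}, Literature.MathematicalPhysics.StatisticalMechanics.lennardJones (dist p (q : EuclideanSpace ℝ (Fin 3))) ≤ ∑' q : {q : EuclideanSpace ℝ (Fin 3) // μ {q} ≠ 0 ∧ q ≠ p}, Literature.MathematicalPhysics.StatisticalMechanics.lennardJones (dist y (q : EuclideanSpace ℝ (Fin 3)))) → P {μ : MeasureTheory.Measure (EuclideanSpace ℝ (Fin 3)) | ∃ Q : Literature.MathematicalPhysics.StatisticalMechanics.PeriodicConfiguration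 3, ∃ t : EuclideanSpace ℝ (Fin 3), {p : EuclideanSpace ℝ (Fin 3) | μ {p} ≠ 0} = (fun s => s + t) '' Q.points} = 0 → (∀ᵐ μ ∂P, μ ∈ Kᶜ) → (⨅ Q : Literature.MathematicalPhysics.StatisticalMechanics.PeriodicConfiguration 3, Q.energyPerParticle Literature.MathematicalPhysics.StatisticalMechanics.lennardJones) < (∫ μ, Literature.MathematicalPhysics.StatisticalMechanics.rootEnergy Literature.MathematicalPhysics.StatisticalMechanics.lennardJones μ ∂P)) := by
  constructor
  · intro h δ hδ P
    have h' := h δ hδ P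
    dsimp only at h' ⊢
    intro hP ha hb hd he h0 _
    exact h' hP ha hb hd he h0
  · intro h δ hδ P
    have h' := h δ hδ
    have hG := hgapK δ hδ
    dsimp only at h' hG ⊢
    intro hP ha hb hd he h0
    have hinvKc : ∀ μ : Measure E3, ∀ p : E3, μ {p} ≠ 0 → (μ ∈ Kᶜ ↔ Measure.map (fun z : E3 => z - p) μ ∈ Kᶜ) :=
      fun μ p hp => by rw [Set.mem_compl_iff, Set.mem_compl_iff, hinvK μ p hp]
    -- junk case: a non-integrable root energy has integral `0 > e⋆`
    by_cases hint : Integrable (fun μ : Measure E3 => rootEnergy lennardJones μ) P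
    swap
    · rw [integral_undef hint]; exact eStar_neg'
    -- the conditioned laws stay in the frame
    have hframe : ∀ (L : Set (Measure E3)), MeasurableSet L →
        (∀ μ : Measure E3, ∀ p : E3, μ {p} ≠ 0 → (μ ∈ L ↔ Measure.map (fun z : E3 => z - p) μ ∈ L)) → P L ≠ 0 →
        IsProbabilityMeasure ((P L)⁻¹ • P.restrict L) ∧
        (∀ᵐ μ ∂((P L)⁻¹ • P.restrict L), IsRootedHardCore δ μ) ∧
        IsPointStationaryLaw ((P L)⁻¹ • P.restrict L) ∧
        (∀ᵐ μ ∂((P L)⁻¹ • P.restrict L), μ ∈ L) ∧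
        ((P L)⁻¹ • P.restrict L) {μ : Measure E3 | ∃ Q : PeriodicConfiguration 3, ∃ t : E3,
            {p : E3 | μ {p} ≠ 0} = (fun s => s + t) '' Q.points} = 0 := by
      intro L hL hinvL hL0
      refine ⟨isProbabilityMeasure_cond' hL0, Measure.ae_smul_measure (ae_restrict_of_ae ha) _,
        (isPointStationaryLaw_restrict_of_invariant hδ ha hb hL hinvL).smul _, Measure.ae_smul_measure (ae_restrict_mem hL) _, ?_⟩
      rw [Measure.smul_apply, smul_eq_mul]
      refine mul_eq_zero_of_right _ (le_antisymm ?_ bot_le)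
      exact (Measure.le_iff'.1 Measure.restrict_le_self _).trans h0.le
    -- the two pieces
    have hpieceK := setIntegral_ge_of_cond (P := P) (K := K) (f := fun μ => rootEnergy lennardJones μ) (c := eStar) (fun hK0 => by
      obtain ⟨hP', ha', hb', hK', h0'⟩ := hframe K hK hinvK hK0
      refine hG _ hP' ha' hb' ?_ ?_ h0' hK'
      · obtain ⟨R₇, R₈, R₉, hd'⟩ := hd
        exact ⟨R₇, R₈, R₉, Measure.ae_smul_measure (ae_restrict_of_ae hd') _⟩
      · exact Measure.ae_smul_measure (ae_restrict_of_ae he) _)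
    have hpieceKc := setIntegral_ge_of_cond (P := P) (K := Kᶜ) (f := fun μ => rootEnergy lennardJones μ) (c := eStar) (fun hK0 => by
      obtain ⟨hP', ha', hb', hK', h0'⟩ := hframe Kᶜ hK.compl hinvKc hK0
      refine h' _ hP' ha' hb' ?_ ?_ h0' hK'
      · obtain ⟨R₇, R₈, R₉, hd'⟩ := hd
        exact ⟨R₇, R₈, R₉, Measure.ae_smul_measure (ae_restrict_of_ae hd') _⟩
      · exact Measure.ae_smul_measure (ae_restrict_of_ae he) _)
    -- add up
    have hsum : ∫ μ in K, rootEnergy lennardJones μ ∂P + ∫ μ in Kᶜ, rootEnergy lennardJones μ ∂P =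
        ∫ μ, rootEnergy lennardJones μ ∂P := integral_add_compl hK hint
    have hmass : (P K).toReal + (P Kᶜ).toReal = 1 := by
      rw [← ENNReal.toReal_add (measure_ne_top P K) (measure_ne_top P Kᶜ), measure_add_measure_compl hK, measure_univ,
        ENNReal.toReal_one]
    rw [← hsum]
    change eStar < _
    have hm' : (P K).toReal * eStar + (P Kᶜ).toReal * eStar = eStar := by rw [← add_mul, hmass, one_mul]
    by_cases hK0 : P K = 0
    · have hKc0 : P Kᶜ ≠ 0 := by
        intro h
        rw [hK0, h, ENNReal.toReal_zero, add_zero] at hmass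
        exact zero_ne_one hmass
      have h1 := hpieceK.1
      have h2 := hpieceKc.2 hKc0
      linarith
    · have h1 := hpieceK.2 hK0
      have h2 := hpieceKc.1
      linarith

/-- **The finite class, peeled off with the generic cut**: the crux is equivalent to its restriction to laws almost surely carried by
configurations of infinite total mass (`μ univ = ∞`; for the rooted hard-core configurations the crux is about, exactly: infinitely many
atoms — cf. `aperiodicFrustratedLawGap_iff_infiniteCase`). [folklore] -/
theorem aperiodicFrustratedLawGap_iff_offFinite :
    Summit.AtomisticToContinuum.Crystallization.Theses.FrustratedLawDichotomy.AperiodicFrustratedLawGap ↔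
    (∀ δ : ℝ, 0 < δ → ∀ P : MeasureTheory.Measure (MeasureTheory.Measure (EuclideanSpace ℝ (Fin 3))), let Gy : ℝ → (N : ℕ) → (Fin N → EuclideanSpace ℝ (Fin 3)) → Fin N → Prop := fun η N y j => let d : ℝ := sInf ((fun z => dist z (y (j : Fin N))) '' (Set.range (y) \ {(y (j : Fin N))})); let T : Set (EuclideanSpace ℝ (Fin 3)) := {z : EuclideanSpace ℝ (Fin 3) | z ∈ Set.range (y) ∧ z ≠ (y (j : Fin N)) ∧ dist z (y (j : Fin N)) < 13 / 10 * d}; ∃ A : EuclideanSpace ℝ (Fin 3) →ₗᵢ[ℝ] EuclideanSpace ℝ (Fin 3), (∃ e : ↥T ≃ ↥Literature.Geometry.DiscreteGeometry.fccKissingPattern, ∀ t : ↥T, dist (d⁻¹ • ((t : EuclideanSpace ℝ (Fin 3)) - (y (j : Fin N)))) (A ((e t : ↥Literature.Geometry.DiscreteGeometry.fccKissingPattern) : EuclideanSpace ℝ (Fin 3))) ≤ η) ∨ (∃ e : ↥T ≃ ↥Literature.Geometry.DiscreteGeometry.hcpKissingPattern, ∀ t : ↥T, dist (d⁻¹ •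 ((t : EuclideanSpace ℝ (Fin 3)) - (y (j : Fin N)))) (A ((e t : ↥Literature.Geometry.DiscreteGeometry.hcpKissingPattern) : EuclideanSpace ℝ (Fin 3))) ≤ η); let TexBall : (N : ℕ) → (Fin N → EuclideanSpace ℝ (Fin 3)) → Fin N → ℝ → ℝ → ℝ → ℝ → Prop := fun N y i R R₇ R₈ R₉ => (∀ a b : Fin N, a ≠ b → (7 : ℝ) / 10 ≤ dist (y a) (y b)) ∧ (∀ j : Fin N, dist (y j) (y i) ≤ R → ¬ Gy (1 / 20) N (y) j) ∧ (∀ j : Fin N, dist (y j) (y i) ≤ R → ¬ ((∀ j' : Fin N, dist (y j') (y j) ≤ R₇ → ¬ Gy (1 / 20) N (y) j') ∧ (∀ z : EuclideanSpace ℝ (Fin 3), dist z (y j) ≤ R₇ → ∃ k : Fin N, dist z (y k) ≤ 1) ∧ (∀ j' : Fin N, dist (y j') (y j) ≤ R₇ → (let d : ℝ := sInf ((fun z => dist z (y j')) '' (Set.range (y) \ {(y j')})); ∀ k : Fin N, y k ≠ y j' → dist (y k) (y j') < 27 / 20 * d → 5 ≤ Nat.card {m : Fin N // y m ≠ y j'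 ∧ dist (y m) (y j') < 27 / 20 * d ∧ y m ≠ y k ∧ dist (y m) (y k) < 27 / 20 * d})))) ∧ (∀ j : Fin N, dist (y j) (y i) ≤ R → ∃ k : Fin N, dist (y k) (y j) ≤ R₈ ∧ Gy (1 / 8) N (y) k) ∧ (∀ j : Fin N, dist (y j) (y i) ≤ R → ¬ ((∀ j' : Fin N, dist (y j') (y j) ≤ R₉ → ¬ Gy (1 / 20) N (y) j') ∧ (Nat.card {j' : Fin N // dist (y j') (y j) ≤ R₉ ∧ ¬ Gy (1 / 8) N (y) j'} : ℝ) ≤ 1 / 2 * (Nat.card {j' : Fin N // dist (y j') (y j) ≤ R₉} : ℝ) ∧ (∀ j' : Fin N, dist (y j') (y j) ≤ R₉ → ¬ Gy (1 / 8) N (y) j' → ¬ (let d : ℝ := sInf ((fun z => dist z (y j')) '' (Set.range (y) \ {(y j')})); ∀ k : Fin N, y k ≠ y j' → dist (y k) (y j') < 27 / 20 * d → 5 ≤ Nat.card {m : Fin N // y m ≠ y j' ∧ dist (y m) (y j') < 27 / 20 * d ∧ y m ≠ y k ∧ dist (y m) (y k) < 27 / 20 * d})))); let Appr : MeasureTheory.Measure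 (EuclideanSpace ℝ (Fin 3)) → ℝ → ℝ → ℝ → Prop := fun μ R₇ R₈ R₉ => ∀ q : EuclideanSpace ℝ (Fin 3), μ {q} ≠ 0 → ∀ R ε : ℝ, 0 < ε → ∃ (N : ℕ) (y : Fin N → EuclideanSpace ℝ (Fin 3)) (i : Fin N), TexBall N y i R R₇ R₈ R₉ ∧ (∀ p : EuclideanSpace ℝ (Fin 3), μ {p} ≠ 0 → dist p q ≤ R → ∃ k : Fin N, dist (y k - y i) (p - q) ≤ ε) ∧ (∀ k : Fin N, dist (y k) (y i) ≤ R → ∃ p : EuclideanSpace ℝ (Fin 3), μ {p} ≠ 0 ∧ dist (y k - y i) (p - q) ≤ ε); MeasureTheory.IsProbabilityMeasure P → (∀ᵐ μ ∂P, Literature.Probability.Process.IsRootedHardCore δ μ) → Literature.Probability.Process.IsPointStationaryLaw P → (∃ R₇ R₈ R₉ : ℝ, ∀ᵐ μ ∂P, Appr μ R₇ R₈ R₉) → (∀ᵐ μ ∂P, ∀ p : EuclideanSpace ℝ (Fin 3), μ {p} ≠ 0 → ∀ y : EuclideanSpace ℝ (Fin 3), (∀ q : EuclideanSpace ℝ (Fin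 3), μ {q} ≠ 0 → q ≠ p → y ≠ q) → ∑' q : {q : EuclideanSpace ℝ (Fin 3) // μ {q} ≠ 0 ∧ q ≠ p}, Literature.MathematicalPhysics.StatisticalMechanics.lennardJones (dist p (q : EuclideanSpace ℝ (Fin 3))) ≤ ∑' q : {q : EuclideanSpace ℝ (Fin 3) // μ {q} ≠ 0 ∧ q ≠ p}, Literature.MathematicalPhysics.StatisticalMechanics.lennardJones (dist y (q : EuclideanSpace ℝ (Fin 3)))) → P {μ : MeasureTheory.Measure (EuclideanSpace ℝ (Fin 3)) | ∃ Q : Literature.MathematicalPhysics.StatisticalMechanics.PeriodicConfiguration 3, ∃ t : EuclideanSpace ℝ (Fin 3), {p : EuclideanSpace ℝ (Fin 3) | μ {p} ≠ 0} = (fun s => s + t) '' Q.points} = 0 → (∀ᵐ μ ∂P, μ ∈ ({μ : MeasureTheory.Measure (EuclideanSpace ℝ (Fin 3)) | μ Set.univ ≠ ⊤} : Set (MeasureTheory.Measure (EuclideanSpace ℝ (Fin 3))))ᶜ) → (⨅ Q : Literature.MathematicalPhysics.StatisticalMechanics.PeriodicConfiguration 3, Q.energyPerParticle Literature.MathematicalPhysics.StatisticalMechanics.lennardJones)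 < (∫ μ, Literature.MathematicalPhysics.StatisticalMechanics.rootEnergy Literature.MathematicalPhysics.StatisticalMechanics.lennardJones μ ∂P)) := by
  have hK : MeasurableSet {μ : Measure E3 | μ univ ≠ ∞} :=
    ((Measure.measurable_coe MeasurableSet.univ) (measurableSet_singleton ∞)).compl
  have hinvK : ∀ μ : Measure E3, ∀ p : E3, μ {p} ≠ 0 →
      (μ ∈ {μ : Measure E3 | μ univ ≠ ∞} ↔ Measure.map (fun z : E3 => z - p) μ ∈ {μ : Measure E3 | μ univ ≠ ∞}) :=
    fun μ p _ => by
      simp only [Set.mem_setOf_eq, Measure.map_apply (measurable_sub_const p) MeasurableSet.univ, Set.preimage_univ]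
  refine aperiodicFrustratedLawGap_cut {μ : Measure E3 | μ univ ≠ ∞} hK hinvK ?_
  intro δ hδ P
  dsimp only
  intro _hP ha hb _ _ _ hfin
  refine eStar_lt_integral_rootEnergy_of_ae_finite hδ ha hb ?_
  filter_upwards [ha, hfin] with μ hμ hμfin
  obtain ⟨S, h0S, hsep, rfl⟩ := hμ
  rw [setOf_count_restrict_singleton_ne_zero]
  by_contra hS
  exact hμfin (count_restrict_univ_of_infinite hS)

end GenericCut


/-! ## §4. The route still closes with the cut piece

With `aperiodicFrustratedLawGap_iff_infiniteCase` the route's deciding theorem `Theses.FrustratedLawDichotomy.closes` accepts the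
infinite-configuration core in place of the crux: `crystallization_of_infiniteCore` (by name, 4 binders, the fourth replaced by the core). -/

section RouteWithCore

/-- **The route closes with the infinite-configuration core in place of the crux**:
`NonTcpCentreCase → TexturedLawTransfer → PeriodicFrustratedLawGap → [Φaper restricted to a.s.-infinite laws] → Crystallization`
(`Theses.FrustratedLawDichotomy.closes` ∘ `aperiodicFrustratedLawGap_iff_infiniteCase.mpr`). [folklore] -/
theorem crystallization_of_infiniteCore
    (h₀ : Summit.AtomisticToContinuum.Crystallization.Theses.FrustratedLawDichotomy.NonTcpCentreCase)
    (hT : Summit.AtomisticToContinuum.Crystallization.Theses.FrustratedLawDichotomy.TexturedLawTransfer)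
    (h₁ : Summit.AtomisticToContinuum.Crystallization.Theses.FrustratedLawDichotomy.PeriodicFrustratedLawGap)
    (h₂ : ∀ δ : ℝ, 0 < δ → ∀ P : MeasureTheory.Measure (MeasureTheory.Measure (EuclideanSpace ℝ (Fin 3))), let Gy : ℝ → (N : ℕ) → (Fin N → EuclideanSpace ℝ (Fin 3)) → Fin N → Prop := fun η N y j => let d : ℝ := sInf ((fun z => dist z (y (j : Fin N))) '' (Set.range (y) \ {(y (j : Fin N))})); let T : Set (EuclideanSpace ℝ (Fin 3)) := {z : EuclideanSpace ℝ (Fin 3) | z ∈ Set.range (y) ∧ z ≠ (y (j : Fin N)) ∧ dist z (y (j : Fin N)) < 13 / 10 * d}; ∃ A : EuclideanSpace ℝ (Fin 3) →ₗᵢ[ℝ] EuclideanSpace ℝ (Fin 3), (∃ e : ↥T ≃ ↥Literature.Geometry.DiscreteGeometry.fccKissingPattern, ∀ t : ↥T, dist (d⁻¹ • ((t : EuclideanSpace ℝ (Fin 3)) - (y (j : Fin N)))) (A ((e t : ↥Literature.Geometry.DiscreteGeometry.fccKissingPattern) : EuclideanSpace ℝ (Fin 3))) ≤ η) ∨ (∃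 e : ↥T ≃ ↥Literature.Geometry.DiscreteGeometry.hcpKissingPattern, ∀ t : ↥T, dist (d⁻¹ • ((t : EuclideanSpace ℝ (Fin 3)) - (y (j : Fin N)))) (A ((e t : ↥Literature.Geometry.DiscreteGeometry.hcpKissingPattern) : EuclideanSpace ℝ (Fin 3))) ≤ η); let TexBall : (N : ℕ) → (Fin N → EuclideanSpace ℝ (Fin 3)) → Fin N → ℝ → ℝ → ℝ → ℝ → Prop := fun N y i R R₇ R₈ R₉ => (∀ a b : Fin N, a ≠ b → (7 : ℝ) / 10 ≤ dist (y a) (y b)) ∧ (∀ j : Fin N, dist (y j) (y i) ≤ R → ¬ Gy (1 / 20) N (y) j) ∧ (∀ j : Fin N, dist (y j) (y i) ≤ R → ¬ ((∀ j' : Fin N, dist (y j') (y j) ≤ R₇ → ¬ Gy (1 / 20) N (y) j') ∧ (∀ z : EuclideanSpace ℝ (Fin 3), dist z (y j) ≤ R₇ → ∃ k : Fin N, dist z (y k) ≤ 1) ∧ (∀ j' : Fin N, dist (y j') (y j) ≤ R₇ → (let d : ℝ := sInf ((fun z => dist z (y j')) '' (Set.range (y) \ {(y j')})); ∀ k : Fin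 N, y k ≠ y j' → dist (y k) (y j') < 27 / 20 * d → 5 ≤ Nat.card {m : Fin N // y m ≠ y j' ∧ dist (y m) (y j') < 27 / 20 * d ∧ y m ≠ y k ∧ dist (y m) (y k) < 27 / 20 * d})))) ∧ (∀ j : Fin N, dist (y j) (y i) ≤ R → ∃ k : Fin N, dist (y k) (y j) ≤ R₈ ∧ Gy (1 / 8) N (y) k) ∧ (∀ j : Fin N, dist (y j) (y i) ≤ R → ¬ ((∀ j' : Fin N, dist (y j') (y j) ≤ R₉ → ¬ Gy (1 / 20) N (y) j') ∧ (Nat.card {j' : Fin N // dist (y j') (y j) ≤ R₉ ∧ ¬ Gy (1 / 8) N (y) j'} : ℝ) ≤ 1 / 2 * (Nat.card {j' : Fin N // dist (y j') (y j) ≤ R₉} : ℝ) ∧ (∀ j' : Fin N, dist (y j') (y j) ≤ R₉ → ¬ Gy (1 / 8) N (y) j' → ¬ (let d : ℝ := sInf ((fun z => dist z (y j')) '' (Set.range (y) \ {(y j')})); ∀ k : Fin N, y k ≠ y j' → dist (y k) (y j') < 27 / 20 * d → 5 ≤ Nat.card {m : Fin N // y m ≠ y j' ∧ dist (y m) (y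 j') < 27 / 20 * d ∧ y m ≠ y k ∧ dist (y m) (y k) < 27 / 20 * d})))); let Appr : MeasureTheory.Measure (EuclideanSpace ℝ (Fin 3)) → ℝ → ℝ → ℝ → Prop := fun μ R₇ R₈ R₉ => ∀ q : EuclideanSpace ℝ (Fin 3), μ {q} ≠ 0 → ∀ R ε : ℝ, 0 < ε → ∃ (N : ℕ) (y : Fin N → EuclideanSpace ℝ (Fin 3)) (i : Fin N), TexBall N y i R R₇ R₈ R₉ ∧ (∀ p : EuclideanSpace ℝ (Fin 3), μ {p} ≠ 0 → dist p q ≤ R → ∃ k : Fin N, dist (y k - y i) (p - q) ≤ ε) ∧ (∀ k : Fin N, dist (y k) (y i) ≤ R → ∃ p : EuclideanSpace ℝ (Fin 3), μ {p} ≠ 0 ∧ dist (y k - y i) (p - q) ≤ ε); MeasureTheory.IsProbabilityMeasure P → (∀ᵐ μ ∂P, Literature.Probability.Process.IsRootedHardCore δ μ) → Literature.Probability.Process.IsPointStationaryLaw P → (∃ R₇ R₈ R₉ : ℝ, ∀ᵐ μ ∂P, Appr μ R₇ R₈ R₉) → (∀ᵐ μ ∂P, ∀ p : EuclideanSpace ℝ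 (Fin 3), μ {p} ≠ 0 → ∀ y : EuclideanSpace ℝ (Fin 3), (∀ q : EuclideanSpace ℝ (Fin 3), μ {q} ≠ 0 → q ≠ p → y ≠ q) → ∑' q : {q : EuclideanSpace ℝ (Fin 3) // μ {q} ≠ 0 ∧ q ≠ p}, Literature.MathematicalPhysics.StatisticalMechanics.lennardJones (dist p (q : EuclideanSpace ℝ (Fin 3))) ≤ ∑' q : {q : EuclideanSpace ℝ (Fin 3) // μ {q} ≠ 0 ∧ q ≠ p}, Literature.MathematicalPhysics.StatisticalMechanics.lennardJones (dist y (q : EuclideanSpace ℝ (Fin 3)))) → P {μ : MeasureTheory.Measure (EuclideanSpace ℝ (Fin 3)) | ∃ Q : Literature.MathematicalPhysics.StatisticalMechanics.PeriodicConfiguration 3, ∃ t : EuclideanSpace ℝ (Fin 3), {p : EuclideanSpace ℝ (Fin 3) | μ {p} ≠ 0} = (fun s => s + t) '' Q.points} = 0 → (∀ᵐ μ ∂P, {p : EuclideanSpace ℝ (Fin 3) | μ {p} ≠ 0}.Infinite) → (⨅ Q : Literature.MathematicalPhysics.StatisticalMechanics.PeriodicConfiguration 3, Q.energyPerParticle Literature.MathematicalPhysics.StatisticalMechanics.lennardJones)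 < (∫ μ, Literature.MathematicalPhysics.StatisticalMechanics.rootEnergy Literature.MathematicalPhysics.StatisticalMechanics.lennardJones μ ∂P)) :
    _root_.Crystallization :=
  Summit.AtomisticToContinuum.Crystallization.Theses.FrustratedLawDichotomy.closes h₀ hT h₁
    (aperiodicFrustratedLawGap_iff_infiniteCase.mpr h₂)

end RouteWithCore

end Summit.AtomisticToContinuum.Crystallization.Theorems.FrustratedLawDichotomyAperiodicGapFiniteCut

end
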